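import Summits.Ventures.LatticeQCDFlow.Exactness.IMHTauIntModelComparison
import HarnessLib

/-!
# The `τ_int` column under a NON-uniform density parity: windowed Green–Kubo sums are pinned up to
# a defect `4e^{−δ}((N+1)B)²·min(w(E), Z·q(E))`

HONEST FRAMING: exact (Metropolis-corrected) sampling algorithms for lattice gauge theory;
figures of merit are autocorrelation/cost numbers at stated couplings and volumes; no
continuum-physics claim.

Venture `LatticeQCDFlow` (cell pub-lqcd), topic `Exactness`; FANOUT row 4 (`s0-u1-b`, rung S0-B:
two independent codes for the 2D U(1) flow sampler, compared by acceptance and `τ_int(Q)`).  NEW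
WORK of the cell over the tree's general-state-space flow sampler `K = imhOp μ w q`, its Dirichlet
form `𝓔_q(v) = ∫ v² w − ∫ v (Kv) w = ½∫∫ s_q (v − v')²`, `s_q(t,t') = min(w(t)q(t'), w(t')q(t))`
(`IMHDirichletForm.dirichlet_eq_half_sq`), the partial Neumann sums and both sides of the
variational principle (`IMHVariationalBound`, `IMHVariationalPrinciple`), assembled exactly as in
`IMHTauIntModelComparison.lean` (UNIFORM parity ⇒ `e^{−δ}(2τ+1) ≤ 2τ'+1 ≤ e^{δ}(2τ+1)`).  Nothing
is cited as a fact; no definition is introduced.  Companion of `Scaling/DensityParityCertificates`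
§2: a parity holding only OFF an exceptional set `E` pins the full `τ_int` of the other model by
NO mass of `E` (two-point witness, `τ' = p(E)/q'(E) − 1/2` at `p(E) = q(E) = ε`).  This file shows
what such a parity DOES pin: every WINDOWED Green–Kubo sum, up to a defect linear in the mass of `E`
under the TARGET or under model A (whichever is smaller) and quadratic in the window.

## What is proved (`(X, μ)` s-finite; `w > 0` measurable integrable, `Z = ∫ w`; `q, q' > 0`
measurable, `∫ q = ∫ q' = 1`; `E` measurable, `|log q t − log q' t| ≤ δ` for `t ∉ E`; `v` measurable,
`|v| ≤ V`; `T = (E × X) ∪ (X × E)`; PARITY DEFECT `D_E(v) = ½∫∫_T s_q (v − v')²`)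

* §1 pointwise: `exp_neg_mul_le_and_of_abs_log_sub_le`, `imhFlow_ge_exp_neg_mul_of_logParity_at`
  (`s_{q'} ≥ e^{−δ} s_q` at a pair of parity points), `sq_sub_le_four_mul_sq`, `imhFlow_le_right`.
* §2 **`dirichlet_ge_exp_neg_mul_sub_parityDefect`**: `𝓔_{q'}(v) ≥ e^{−δ}·(𝓔_q(v) − D_E(v))`;
  **`parityDefect_le_targetMass`**: `D_E(v) ≤ 4V²·∫_E w`; **`parityDefect_le_modelMass`**:
  `D_E(v) ≤ 4V²·Z·∫_E q` (`s_q ≤ w(t)q(t')`, `s_q ≤ w(t')q(t)`, `(v − v')² ≤ 4V²`, Fubini).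
* §3 **`partialSum_autocov_le_of_logParityOff`**: `g` bounded measurable (`|g| ≤ B`) with summable
  autocovariances `C(k) = ∫ g (Kᵏ g) w`, `S = C(0) + Σ_{k≥0} C(k+1)`, `K' = imhOp μ w q'`; for all `N`
  `Σ_{k≤N} ∫ g (K'ᵏ g) w ≤ e^{δ}·S + e^{−δ}·4((N+1)B)²·min(∫_E w, Z·∫_E q)` (test function
  `e^{−δ} v'_N`, `|v'_N| ≤ (N+1)B`); **`imhOp_tauIntWindow_le_of_logParityOff`** — on
  `Scoring.tauIntWindow` / `Scoring.tauInt` (`ρ = C/∫g²w`, `∫ g² w > 0`):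
  `τ'_N + ½ ≤ e^{δ}(τ + ½) + e^{−δ}·4((N+1)B)²·min(∫_E w, Z∫_E q)/∫ g² w`.

Reading for row 4 (value-free; no number of ours, no sealed value): under a parity that fails on
`E`, the acceptance column moves by the MODEL masses of `E` (`FlowAcceptanceModelLipschitz`), the
ESS column by the TARGET-WEIGHTED importance masses of `E` (`Scaling/DensityParityTargetSide`), the
full `τ_int` column by no mass of `E` — and the WINDOWED `τ` (what a Γ-method window `N` reports) by
at most `4e^{−δ}(N+1)²·(B²/∫g²w)·min(w(E), Z q(E))` beyond the uniform allowance `e^δ(τ + ½)`: a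
parity failure of small target-or-model mass inflates the other code's autocorrelation only through
long sticking episodes.  For the witness's own observable (`g = 1_E`, `B²/∫g²w ≈ 1/π(E)`) the bound
is void, as it must be.  NOT CLAIMED: sharpness of `4` or of `N²`; the reverse inequality (needs
summability under `K'`; symmetric); HMC / local Metropolis; unbounded observables; numbers re-scored.
-/

namespace Summit.Ventures.LatticeQCDFlow.Exactness

open Real MeasureTheory Filter Set Topology
open Summit.Ventures.LatticeQCDFlow.Scoring

variable {X : Type*} [MeasurableSpace X] {μ : Measure X} {w q : X → ℝ}

/-! ## §1 Pointwise -/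

/-- `|log a − log b| ≤ δ` for `a, b > 0` gives `e^{−δ} a ≤ b` and `e^{−δ} b ≤ a`. [folklore] -/
theorem exp_neg_mul_le_and_of_abs_log_sub_le {a b δ : ℝ} (ha : 0 < a) (hb : 0 < b)
    (h : |Real.log a - Real.log b| ≤ δ) : Real.exp (-δ) * a ≤ b ∧ Real.exp (-δ) * b ≤ a := by
  have h' := abs_le.1 h
  constructor
  · have h1 : Real.exp (-δ) ≤ Real.exp (Real.log b - Real.log a) :=
      Real.exp_le_exp.2 (by linarith [h'.2])
    rw [Real.exp_sub, Real.exp_log hb, Real.exp_log ha, le_div_iff₀ ha] at h1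
    exact h1
  · have h1 : Real.exp (-δ) ≤ Real.exp (Real.log a - Real.log b) :=
      Real.exp_le_exp.2 (by linarith [h'.1])
    rw [Real.exp_sub, Real.exp_log ha, Real.exp_log hb, le_div_iff₀ hb] at h1
    exact h1

omit [MeasurableSpace X] in
/-- **Local flow domination**: if the parity holds at `t` AND at `t'` then
`e^{−δ} s_q(t,t') ≤ s_{q'}(t,t')`. -/
theorem imhFlow_ge_exp_neg_mul_of_logParity_at {q' : X → ℝ} (hw0 : ∀ t, 0 < w t)
    (hq0 : ∀ t, 0 < q t) (hq0' : ∀ t, 0 < q' t) {δ : ℝ} {t t' : X}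
    (ht : |Real.log (q t) - Real.log (q' t)| ≤ δ) (ht' : |Real.log (q t') - Real.log (q' t')| ≤ δ) :
    Real.exp (-δ) * imhFlow w q t t' ≤ imhFlow w q' t t' := by
  unfold imhFlow
  rw [mul_min_of_nonneg _ _ (Real.exp_pos _).le]
  refine min_le_min ?_ ?_
  · calc Real.exp (-δ) * (w t * q t') = w t * (Real.exp (-δ) * q t') := by ring
      _ ≤ w t * q' t' := mul_le_mul_of_nonneg_left
          (exp_neg_mul_le_and_of_abs_log_sub_le (hq0 t') (hq0' t') ht').1 (hw0 t).le
  · calc Real.exp (-δ) * (w t' * q t) = w t' * (Real.exp (-δ) * q t) := by ring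
      _ ≤ w t' * q' t := mul_le_mul_of_nonneg_left
          (exp_neg_mul_le_and_of_abs_log_sub_le (hq0 t) (hq0' t) ht).1 (hw0 t').le

/-- `(a − b)² ≤ 4V²` for `|a|, |b| ≤ V`. [folklore] -/
theorem sq_sub_le_four_mul_sq {a b V : ℝ} (ha : |a| ≤ V) (hb : |b| ≤ V) : (a - b) ^ 2 ≤ 4 * V ^ 2 := by
  have h : |a - b| ≤ 2 * V := (abs_sub a b).trans (by linarith)
  calc (a - b) ^ 2 = |a - b| ^ 2 := (sq_abs _).symm
    _ ≤ (2 * V) ^ 2 := pow_le_pow_left₀ (abs_nonneg _) h 2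
    _ = 4 * V ^ 2 := by ring

omit [MeasurableSpace X] in
/-- The other half of `imhFlow_nonneg_le`: `s_q(t,t') ≤ w(t') q(t)`. -/
theorem imhFlow_le_right (w q : X → ℝ) (t t' : X) : imhFlow w q t t' ≤ w t' * q t :=
  min_le_right _ _

/-! ## §2 The Dirichlet form under a parity off `E`: domination up to the parity defect -/

variable [SFinite μ]

omit [SFinite μ] in
/-- The exceptional pair set `T = (E × X) ∪ (X × E)` is measurable. -/
theorem measurableSet_paritySet {E : Set X} (hE : MeasurableSet E) :
    MeasurableSet ((E ×ˢ (univ : Set X)) ∪ ((univ : Set X) ×ˢ E)) :=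
  (hE.prod MeasurableSet.univ).union (MeasurableSet.univ.prod hE)

omit [SFinite μ] [MeasurableSpace X] in
/-- Off `T` both coordinates are parity points. -/
theorem not_mem_paritySet {E : Set X} {p : X × X}
    (hp : p ∉ (E ×ˢ (univ : Set X)) ∪ ((univ : Set X) ×ˢ E)) : p.1 ∉ E ∧ p.2 ∉ E := by
  simp only [mem_union, mem_prod, mem_univ, and_true, true_and, not_or] at hp
  exact hp

/-- **DIRICHLET DOMINATION UP TO THE PARITY DEFECT.**  At a common target `w`, if the model
densities agree to `δ` in log off `E` then for every bounded measurable `v`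
`e^{−δ}·(𝓔_q(v) − ½∫∫_T s_q (v − v')²) ≤ 𝓔_{q'}(v)`. -/
theorem dirichlet_ge_exp_neg_mul_sub_parityDefect {q' : X → ℝ} (hw0 : ∀ t, 0 < w t)
    (hwm : Measurable w) (hwi : Integrable w μ) (hq0 : ∀ t, 0 < q t) (hqm : Measurable q)
    (hqi : Integrable q μ) (hq1 : ∫ z, q z ∂μ = 1) (hq0' : ∀ t, 0 < q' t) (hqm' : Measurable q')
    (hqi' : Integrable q' μ) (hq1' : ∫ z, q' z ∂μ = 1) {E : Set X} (hE : MeasurableSet E)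
    {δ : ℝ} (hlog : ∀ t, t ∉ E → |Real.log (q t) - Real.log (q' t)| ≤ δ) {v : X → ℝ}
    (hvm : Measurable v) {V : ℝ} (hvb : ∀ t, |v t| ≤ V) :
    Real.exp (-δ) * (((∫ t, v t ^ 2 * w t ∂μ) - ∫ t, v t * imhOp μ w q v t * w t ∂μ)
        - (1 / 2) * ∫ p, ((E ×ˢ (univ : Set X)) ∪ ((univ : Set X) ×ˢ E)).indicator
            (fun p : X × X => imhFlow w q p.1 p.2 * (v p.1 - v p.2) ^ 2) p ∂(μ.prod μ))
      ≤ (∫ t, v t ^ 2 * w t ∂μ) - ∫ t, v t * imhOp μ w q' v t * w t ∂μ := by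
  set T := (E ×ˢ (univ : Set X)) ∪ ((univ : Set X) ×ˢ E) with hTdef
  have hT : MeasurableSet T := measurableSet_paritySet hE
  have hF := integrable_imhFlow_sq_sub hw0 hwm hwi hq0 hqm hqi hvm hvb
  have hF' := integrable_imhFlow_sq_sub hw0 hwm hwi hq0' hqm' hqi' hvm hvb
  have hTF : Integrable (T.indicator fun p : X × X => imhFlow w q p.1 p.2 * (v p.1 - v p.2) ^ 2)
      (μ.prod μ) := hF.indicator hT
  rw [dirichlet_eq_half_sq hw0 hwm hwi hq0 hqm hqi hq1 hvm hvb,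
    dirichlet_eq_half_sq hw0 hwm hwi hq0' hqm' hqi' hq1' hvm hvb, ← mul_sub, ← mul_assoc,
    mul_comm (Real.exp (-δ)), mul_assoc, ← integral_sub hF hTF, ← integral_const_mul]
  refine mul_le_mul_of_nonneg_left ?_ (by norm_num)
  refine integral_mono (((hF.sub hTF)).const_mul _) hF' fun p => ?_
  dsimp only
  by_cases hp : p ∈ T
  · rw [indicator_of_mem hp, sub_self, mul_zero]
    exact mul_nonneg (imhFlow_nonneg_le hw0 hq0' p.1 p.2).1 (sq_nonneg _)
  · rw [indicator_of_notMem hp, sub_zero, ← mul_assoc]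
    obtain ⟨h1, h2⟩ := not_mem_paritySet hp
    exact mul_le_mul_of_nonneg_right
      (imhFlow_ge_exp_neg_mul_of_logParity_at hw0 hq0 hq0' (hlog _ h1) (hlog _ h2)) (sq_nonneg _)

omit [MeasurableSpace X] [SFinite μ] in
/-- Pointwise domination of the defect integrand: if `s_q(t,t') ≤ a(t)b(t')` and
`s_q(t,t') ≤ a(t')b(t)` with `a, b ≥ 0` then
`1_T s_q (v − v')² ≤ (4V²·1_E a)(t)·b(t') + b(t)·(4V²·1_E a)(t')`. -/
theorem paritySet_indicator_le {E : Set X} (hw0 : ∀ t, 0 < w t) (hq0 : ∀ t, 0 < q t)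
    {a b : X → ℝ} (ha0 : ∀ t, 0 ≤ a t) (hb0 : ∀ t, 0 ≤ b t)
    (hab : ∀ t t', imhFlow w q t t' ≤ a t * b t') (hab' : ∀ t t', imhFlow w q t t' ≤ a t' * b t)
    {v : X → ℝ} {V : ℝ} (hvb : ∀ t, |v t| ≤ V) (p : X × X) :
    ((E ×ˢ (univ : Set X)) ∪ ((univ : Set X) ×ˢ E)).indicator
        (fun p : X × X => imhFlow w q p.1 p.2 * (v p.1 - v p.2) ^ 2) p
      ≤ (4 * V ^ 2 * E.indicator a p.1) * b p.2 + b p.1 * (4 * V ^ 2 * E.indicator a p.2) := by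
  have hsq : (v p.1 - v p.2) ^ 2 ≤ 4 * V ^ 2 := sq_sub_le_four_mul_sq (hvb p.1) (hvb p.2)
  have hs0 := (imhFlow_nonneg_le hw0 hq0 p.1 p.2).1
  have hV2 : 0 ≤ 4 * V ^ 2 := by positivity
  have hG1 : 0 ≤ (4 * V ^ 2 * E.indicator a p.1) * b p.2 :=
    mul_nonneg (mul_nonneg hV2 (indicator_nonneg (fun t _ => ha0 t) _)) (hb0 _)
  have hG2 : 0 ≤ b p.1 * (4 * V ^ 2 * E.indicator a p.2) :=
    mul_nonneg (hb0 _) (mul_nonneg hV2 (indicator_nonneg (fun t _ => ha0 t) _))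
  by_cases hp : p ∈ (E ×ˢ (univ : Set X)) ∪ ((univ : Set X) ×ˢ E)
  · rw [indicator_of_mem hp]
    by_cases h1 : p.1 ∈ E
    · rw [indicator_of_mem h1]
      calc imhFlow w q p.1 p.2 * (v p.1 - v p.2) ^ 2 ≤ (a p.1 * b p.2) * (4 * V ^ 2) :=
            mul_le_mul (hab _ _) hsq (sq_nonneg _) (mul_nonneg (ha0 _) (hb0 _))
        _ = (4 * V ^ 2 * a p.1) * b p.2 := by ring
        _ ≤ (4 * V ^ 2 * a p.1) * b p.2 + b p.1 * (4 * V ^ 2 * E.indicator a p.2) :=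
            le_add_of_nonneg_right hG2
    · have h2 : p.2 ∈ E := by
        simp only [mem_union, mem_prod, mem_univ, and_true, true_and] at hp
        exact hp.resolve_left h1
      rw [indicator_of_mem h2]
      calc imhFlow w q p.1 p.2 * (v p.1 - v p.2) ^ 2 ≤ (a p.2 * b p.1) * (4 * V ^ 2) :=
            mul_le_mul (hab' _ _) hsq (sq_nonneg _) (mul_nonneg (ha0 _) (hb0 _))
        _ = b p.1 * (4 * V ^ 2 * a p.2) := by ring
        _ ≤ (4 * V ^ 2 * E.indicator a p.1) * b p.2 + b p.1 * (4 * V ^ 2 * a p.2) :=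
            le_add_of_nonneg_left hG1
  · rw [indicator_of_notMem hp]
    exact add_nonneg hG1 hG2

/-- The parity defect against a product domination (`s_q ≤ a ⊗ b` both ways round, `a, b ≥ 0`
integrable): `½∫∫_T s_q (v − v')² ≤ 4V²·(∫_E a)·(∫ b)` (Fubini). -/
theorem parityDefect_le_of_dominated (hw0 : ∀ t, 0 < w t) (hwm : Measurable w)
    (hwi : Integrable w μ) (hq0 : ∀ t, 0 < q t) (hqm : Measurable q) (hqi : Integrable q μ)
    {a b : X → ℝ} (ha0 : ∀ t, 0 ≤ a t) (hb0 : ∀ t, 0 ≤ b t) (hai : Integrable a μ)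
    (hbi : Integrable b μ) (hab : ∀ t t', imhFlow w q t t' ≤ a t * b t')
    (hab' : ∀ t t', imhFlow w q t t' ≤ a t' * b t) {E : Set X} (hE : MeasurableSet E)
    {v : X → ℝ} (hvm : Measurable v) {V : ℝ} (hvb : ∀ t, |v t| ≤ V) :
    (1 / 2) * ∫ p, ((E ×ˢ (univ : Set X)) ∪ ((univ : Set X) ×ˢ E)).indicator
        (fun p : X × X => imhFlow w q p.1 p.2 * (v p.1 - v p.2) ^ 2) p ∂(μ.prod μ)
      ≤ 4 * V ^ 2 * (∫ t in E, a t ∂μ) * ∫ t, b t ∂μ := by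
  have hEa : Integrable (fun t => 4 * V ^ 2 * E.indicator a t) μ := (hai.indicator hE).const_mul _
  have hG1 : Integrable (fun p : X × X => (4 * V ^ 2 * E.indicator a p.1) * b p.2) (μ.prod μ) :=
    hEa.mul_prod hbi
  have hG2 : Integrable (fun p : X × X => b p.1 * (4 * V ^ 2 * E.indicator a p.2)) (μ.prod μ) :=
    hbi.mul_prod hEa
  have hF := integrable_imhFlow_sq_sub hw0 hwm hwi hq0 hqm hqi hvm hvb
  have hI : ∫ t, 4 * V ^ 2 * E.indicator a t ∂μ = 4 * V ^ 2 * ∫ t in E, a t ∂μ := by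
    rw [integral_const_mul, integral_indicator hE]
  have hle : ∫ p, ((E ×ˢ (univ : Set X)) ∪ ((univ : Set X) ×ˢ E)).indicator
        (fun p : X × X => imhFlow w q p.1 p.2 * (v p.1 - v p.2) ^ 2) p ∂(μ.prod μ)
      ≤ 2 * (4 * V ^ 2 * (∫ t in E, a t ∂μ) * ∫ t, b t ∂μ) := by
    calc ∫ p, ((E ×ˢ (univ : Set X)) ∪ ((univ : Set X) ×ˢ E)).indicator
          (fun p : X × X => imhFlow w q p.1 p.2 * (v p.1 - v p.2) ^ 2) p ∂(μ.prod μ)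
        ≤ ∫ p, ((4 * V ^ 2 * E.indicator a p.1) * b p.2 + b p.1 * (4 * V ^ 2 * E.indicator a p.2))
            ∂(μ.prod μ) :=
          integral_mono (hF.indicator (measurableSet_paritySet hE)) (hG1.add hG2) fun p =>
            paritySet_indicator_le hw0 hq0 ha0 hb0 hab hab' hvb p
      _ = (∫ t, 4 * V ^ 2 * E.indicator a t ∂μ) * (∫ t, b t ∂μ)
            + (∫ t, b t ∂μ) * ∫ t, 4 * V ^ 2 * E.indicator a t ∂μ := by
          rw [integral_add hG1 hG2, integral_prod_mul (fun t => 4 * V ^ 2 * E.indicator a t) b,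
            integral_prod_mul b (fun t => 4 * V ^ 2 * E.indicator a t)]
      _ = 2 * (4 * V ^ 2 * (∫ t in E, a t ∂μ) * ∫ t, b t ∂μ) := by rw [hI]; ring
  linarith

/-- **THE PARITY DEFECT IS AT MOST `4V²` TIMES THE TARGET MASS OF `E`**:
`½∫∫_T s_q (v − v')² ≤ 4V²·∫_E w dμ` (`s_q ≤ w ⊗ q`, `∫ q = 1`). -/
theorem parityDefect_le_targetMass (hw0 : ∀ t, 0 < w t) (hwm : Measurable w)
    (hwi : Integrable w μ) (hq0 : ∀ t, 0 < q t) (hqm : Measurable q) (hqi : Integrable q μ)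
    (hq1 : ∫ z, q z ∂μ = 1) {E : Set X} (hE : MeasurableSet E) {v : X → ℝ} (hvm : Measurable v)
    {V : ℝ} (hvb : ∀ t, |v t| ≤ V) :
    (1 / 2) * ∫ p, ((E ×ˢ (univ : Set X)) ∪ ((univ : Set X) ×ˢ E)).indicator
        (fun p : X × X => imhFlow w q p.1 p.2 * (v p.1 - v p.2) ^ 2) p ∂(μ.prod μ)
      ≤ 4 * V ^ 2 * ∫ t in E, w t ∂μ := by
  have h := parityDefect_le_of_dominated hw0 hwm hwi hq0 hqm hqi (fun t => (hw0 t).le)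
    (fun t => (hq0 t).le) hwi hqi (fun t t' => (imhFlow_nonneg_le hw0 hq0 t t').2)
    (fun t t' => imhFlow_le_right w q t t') hE hvm hvb
  rwa [hq1, mul_one] at h

/-- **… AND AT MOST `4V²·Z` TIMES THE MODEL MASS OF `E`**:
`½∫∫_T s_q (v − v')² ≤ 4V²·(∫ w)·∫_E q dμ` (`s_q ≤ q ⊗ w` both ways round). -/
theorem parityDefect_le_modelMass (hw0 : ∀ t, 0 < w t) (hwm : Measurable w)
    (hwi : Integrable w μ) (hq0 : ∀ t, 0 < q t) (hqm : Measurable q) (hqi : Integrable q μ)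
    {E : Set X} (hE : MeasurableSet E) {v : X → ℝ} (hvm : Measurable v) {V : ℝ}
    (hvb : ∀ t, |v t| ≤ V) :
    (1 / 2) * ∫ p, ((E ×ˢ (univ : Set X)) ∪ ((univ : Set X) ×ˢ E)).indicator
        (fun p : X × X => imhFlow w q p.1 p.2 * (v p.1 - v p.2) ^ 2) p ∂(μ.prod μ)
      ≤ 4 * V ^ 2 * (∫ t, w t ∂μ) * ∫ t in E, q t ∂μ := by
  have h := parityDefect_le_of_dominated hw0 hwm hwi hq0 hqm hqi (fun t => (hq0 t).le)
    (fun t => (hw0 t).le) hqi hwi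
    (fun t t' => (imhFlow_le_right w q t t').trans_eq (mul_comm _ _))
    (fun t t' => (imhFlow_nonneg_le hw0 hq0 t t').2.trans_eq (mul_comm _ _)) hE hvm hvb
  calc _ ≤ 4 * V ^ 2 * (∫ t in E, q t ∂μ) * ∫ t, w t ∂μ := h
    _ = 4 * V ^ 2 * (∫ t, w t ∂μ) * ∫ t in E, q t ∂μ := by ring

/-! ## §3 The windowed Green–Kubo sums and `τ`-windows of the other model -/

/-- **THE WINDOWED GREEN–KUBO SUMS UNDER A PARITY OFF `E`.**  `w > 0` measurable integrable
(`Z = ∫ w`); two models `q, q' > 0` measurable with `∫ q = ∫ q' = 1` that agree to `δ` in log off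
a measurable set `E`; `g` bounded measurable (`|g| ≤ B`) with summable autocovariances under
`K = imhOp μ w q`.  Then for every `N`, with `K' = imhOp μ w q'`:
`Σ_{k≤N} ∫ g (K'ᵏ g) w ≤ e^{δ}·(∫ g² w + Σ_{k≥0} ∫ g (K^{k+1} g) w)
  + e^{−δ}·4((N+1)B)²·min(∫_E w, Z·∫_E q)`. -/
theorem partialSum_autocov_le_of_logParityOff {q' : X → ℝ} (hw0 : ∀ t, 0 < w t)
    (hwm : Measurable w) (hwi : Integrable w μ) (hq0 : ∀ t, 0 < q t) (hqm : Measurable q)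
    (hqi : Integrable q μ) (hq1 : ∫ z, q z ∂μ = 1) (hq0' : ∀ t, 0 < q' t) (hqm' : Measurable q')
    (hqi' : Integrable q' μ) (hq1' : ∫ z, q' z ∂μ = 1) {E : Set X} (hE : MeasurableSet E)
    {δ : ℝ} (hlog : ∀ t, t ∉ E → |Real.log (q t) - Real.log (q' t)| ≤ δ) {g : X → ℝ}
    (hgm : Measurable g) {B : ℝ} (hgb : ∀ t, |g t| ≤ B)
    (hs : Summable fun k => ∫ t, g t * ((imhOp μ w q)^[k + 1] g) t * w t ∂μ) (N : ℕ) :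
    ∑ k ∈ Finset.range (N + 1), ∫ t, g t * ((imhOp μ w q')^[k] g) t * w t ∂μ
      ≤ Real.exp δ * ((∫ t, g t ^ 2 * w t ∂μ) + ∑' k, ∫ t, g t * ((imhOp μ w q)^[k + 1] g) t * w t ∂μ)
        + Real.exp (-δ) * (4 * (((N : ℝ) + 1) * B) ^ 2
            * min (∫ t in E, w t ∂μ) ((∫ t, w t ∂μ) * ∫ t in E, q t ∂μ)) := by
  obtain ⟨hm, hb, -⟩ := neumannSum_facts hw0 hwm hq0' hqm' hqi' hq1' hgm hgb N
  have hdir' := dirichlet_neumannSum_le hw0 hwm hwi hq0' hqm' hqi' hq1' hgm hgb N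
  set c : ℝ := Real.exp (-δ) with hcdef
  have hc : 0 < c := Real.exp_pos _
  -- `∫ g v'_N w = Σ_k C'(k)`
  have hterm : ∀ k, Integrable (fun t => g t * ((imhOp μ w q')^[k] g) t * w t) μ := fun k => by
    obtain ⟨hkm, hkb⟩ := imhOp_iterate_bdd (μ := μ) hw0 hwm hq0' hqm' hqi' hq1' k hgm hgb
    exact integrable_mul_mul_weight hw0 hwm hwi hgm hkm hgb hkb
  have hinner : ∫ t, g t * (∑ k ∈ Finset.range (N + 1), ((imhOp μ w q')^[k] g) t) * w t ∂μ
      = ∑ k ∈ Finset.range (N + 1), ∫ t, g t * ((imhOp μ w q')^[k] g) t * w t ∂μ := by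
    rw [← integral_finsetSum _ fun k _ => hterm k]
    refine integral_congr_ae (Eventually.of_forall fun t => ?_)
    show g t * (∑ k ∈ Finset.range (N + 1), ((imhOp μ w q')^[k] g) t) * w t
      = ∑ k ∈ Finset.range (N + 1), g t * ((imhOp μ w q')^[k] g) t * w t
    rw [Finset.mul_sum, Finset.sum_mul]
  -- Dirichlet domination up to the defect at `v'_N`, and the two defect bounds
  have hcmp := dirichlet_ge_exp_neg_mul_sub_parityDefect hw0 hwm hwi hq0 hqm hqi hq1 hq0' hqm' hqi'
    hq1' hE hlog hm hb
  have hD1 := parityDefect_le_targetMass hw0 hwm hwi hq0 hqm hqi hq1 hE hm hb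
  have hD2 := parityDefect_le_modelMass hw0 hwm hwi hq0 hqm hqi hE hm hb
  -- the test function `c · v'_N` in the variational principle for `K`
  have hcm : Measurable fun x => c * ∑ k ∈ Finset.range (N + 1), ((imhOp μ w q')^[k] g) x :=
    hm.const_mul c
  have hcb : ∀ x, |c * ∑ k ∈ Finset.range (N + 1), ((imhOp μ w q')^[k] g) x| ≤ c * (((N : ℝ) + 1) * B) :=
    fun x => by rw [abs_mul, abs_of_pos hc]; exact mul_le_mul_of_nonneg_left (hb x) hc.le
  have hvar := two_inner_sub_dirichlet_le_greenKubo hw0 hwm hwi hq0 hqm hqi hq1 hgm hgb hs hcm hcb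
  rw [dirichlet_const_mul] at hvar
  have hlin : ∫ t, g t * (c * ∑ k ∈ Finset.range (N + 1), ((imhOp μ w q')^[k] g) t) * w t ∂μ
      = c * ∫ t, g t * (∑ k ∈ Finset.range (N + 1), ((imhOp μ w q')^[k] g) t) * w t ∂μ := by
    rw [← integral_const_mul]
    exact integral_congr_ae (Eventually.of_forall fun t => by ring)
  rw [hlin, hinner] at hvar
  -- abbreviations
  set P : ℝ := ∑ k ∈ Finset.range (N + 1), ∫ t, g t * ((imhOp μ w q')^[k] g) t * w t ∂μ with hP
  set S : ℝ := (∫ t, g t ^ 2 * w t ∂μ) + ∑' k, ∫ t, g t * ((imhOp μ w q)^[k + 1] g) t * w t ∂μ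
    with hS
  set D : ℝ := (1 / 2) * ∫ p, ((E ×ˢ (univ : Set X)) ∪ ((univ : Set X) ×ˢ E)).indicator
      (fun p : X × X => imhFlow w q p.1 p.2 *
        ((∑ k ∈ Finset.range (N + 1), ((imhOp μ w q')^[k] g) p.1)
          - ∑ k ∈ Finset.range (N + 1), ((imhOp μ w q')^[k] g) p.2) ^ 2) p ∂(μ.prod μ) with hD
  set M : ℝ := min (∫ t in E, w t ∂μ) ((∫ t, w t ∂μ) * ∫ t in E, q t ∂μ) with hM
  have hDM : D ≤ 4 * (((N : ℝ) + 1) * B) ^ 2 * M := by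
    rcases le_total (∫ t in E, w t ∂μ) ((∫ t, w t ∂μ) * ∫ t in E, q t ∂μ) with h | h
    · rw [hM, min_eq_left h]; exact hD1
    · rw [hM, min_eq_right h]; linarith [hD2]
  -- assemble: `c·P ≤ 2cP − c𝓔'(v') ≤ 2cP − c²𝓔(v') + c²D ≤ S + c²D`
  have hexp : Real.exp δ = c⁻¹ := by rw [hcdef, Real.exp_neg, inv_inv]
  rw [hexp]
  have key : c * P ≤ S + c ^ 2 * D := by
    nlinarith [mul_le_mul_of_nonneg_left hdir' hc.le, mul_le_mul_of_nonneg_left hcmp hc.le, hvar]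
  have key3 : c * P ≤ S + c ^ 2 * (4 * (((N : ℝ) + 1) * B) ^ 2 * M) := by
    have h := mul_le_mul_of_nonneg_left hDM (sq_nonneg c)
    linarith
  calc P = c⁻¹ * (c * P) := by rw [← mul_assoc, inv_mul_cancel₀ hc.ne', one_mul]
    _ ≤ c⁻¹ * (S + c ^ 2 * (4 * (((N : ℝ) + 1) * B) ^ 2 * M)) :=
        mul_le_mul_of_nonneg_left key3 (inv_pos.2 hc).le
    _ = c⁻¹ * S + c * (4 * (((N : ℝ) + 1) * B) ^ 2 * M) := by
        rw [mul_add, pow_two, mul_assoc c c, ← mul_assoc c⁻¹ c, inv_mul_cancel₀ hc.ne', one_mul]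

/-- **THE `τ`-WINDOW OF THE OTHER MODEL UNDER A PARITY OFF `E`.**  In the setting of
`partialSum_autocov_le_of_logParityOff` with `∫ g² w > 0`, on `Scoring.tauIntWindow` /
`Scoring.tauInt` (`ρ(k) = ∫ g (Kᵏ g) w / ∫ g² w`): for every window `N`,
`τ'_N + ½ ≤ e^{δ}(τ + ½) + e^{−δ}·4((N+1)B)²·min(∫_E w, Z∫_E q)/∫ g² w`. -/
theorem imhOp_tauIntWindow_le_of_logParityOff {q' : X → ℝ} (hw0 : ∀ t, 0 < w t)
    (hwm : Measurable w) (hwi : Integrable w μ) (hq0 : ∀ t, 0 < q t) (hqm : Measurable q)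
    (hqi : Integrable q μ) (hq1 : ∫ z, q z ∂μ = 1) (hq0' : ∀ t, 0 < q' t) (hqm' : Measurable q')
    (hqi' : Integrable q' μ) (hq1' : ∫ z, q' z ∂μ = 1) {E : Set X} (hE : MeasurableSet E)
    {δ : ℝ} (hlog : ∀ t, t ∉ E → |Real.log (q t) - Real.log (q' t)| ≤ δ) {g : X → ℝ}
    (hgm : Measurable g) {B : ℝ} (hgb : ∀ t, |g t| ≤ B)
    (hs : Summable fun k => ∫ t, g t * ((imhOp μ w q)^[k + 1] g) t * w t ∂μ)
    (hA : 0 < ∫ t, g t ^ 2 * w t ∂μ) (N : ℕ) :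
    tauIntWindow (fun k => (∫ t, g t * ((imhOp μ w q')^[k] g) t * w t ∂μ) / ∫ t, g t ^ 2 * w t ∂μ) N
        + 1 / 2
      ≤ Real.exp δ * (tauInt (fun k => (∫ t, g t * ((imhOp μ w q)^[k] g) t * w t ∂μ)
            / ∫ t, g t ^ 2 * w t ∂μ) + 1 / 2)
        + Real.exp (-δ) * (4 * (((N : ℝ) + 1) * B) ^ 2
            * min (∫ t in E, w t ∂μ) ((∫ t, w t ∂μ) * ∫ t in E, q t ∂μ)) / ∫ t, g t ^ 2 * w t ∂μ := by
  have hmain := partialSum_autocov_le_of_logParityOff hw0 hwm hwi hq0 hqm hqi hq1 hq0' hqm' hqi' hq1'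
    hE hlog hgm hgb hs N
  set A : ℝ := ∫ t, g t ^ 2 * w t ∂μ with hAdef
  set C' : ℕ → ℝ := fun k => ∫ t, g t * ((imhOp μ w q')^[k] g) t * w t ∂μ with hC'def
  set T : ℝ := ∑' k, ∫ t, g t * ((imhOp μ w q)^[k + 1] g) t * w t ∂μ with hTdef
  set R : ℝ := Real.exp (-δ) * (4 * (((N : ℝ) + 1) * B) ^ 2
      * min (∫ t in E, w t ∂μ) ((∫ t, w t ∂μ) * ∫ t in E, q t ∂μ)) with hRdef
  have hC0 : C' 0 = A := by
    simp only [hC'def, Function.iterate_zero, id_eq, hAdef]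
    exact integral_congr_ae (Eventually.of_forall fun t => by ring)
  -- `Σ_{k≤N} C'(k) = A + Σ_{t<N} C'(t+1)`
  have hsplit : ∑ k ∈ Finset.range (N + 1), C' k = A + ∑ t ∈ Finset.range N, C' (t + 1) := by
    rw [Finset.sum_range_succ', hC0, add_comm]
  simp only [tauIntWindow, tauInt]
  rw [tsum_div_const, ← Finset.sum_div]
  have hAne := hA.ne'
  -- left side `= (Σ_{k≤N} C'(k))/A`, right side `= e^δ (A + T)/A + R/A`
  have e1 : 1 / 2 + (∑ t ∈ Finset.range N, C' (t + 1)) / A + 1 / 2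
      = (∑ k ∈ Finset.range (N + 1), C' k) / A := by
    rw [hsplit]; field_simp; ring
  have e2 : Real.exp δ * (1 / 2 + T / A + 1 / 2) + R / A = (Real.exp δ * (A + T) + R) / A := by
    field_simp; ring
  rw [e1, e2]
  exact div_le_div_of_nonneg_right hmain hA.le

end Summit.Ventures.LatticeQCDFlow.Exactness
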